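import Summits.AtomisticToContinuum.HydrodynamicLimit.Theorems.OneFlightGossipEngineEquilibriumClampedCollisionalWindowLDStubCollisionDecompositionRecords
import Summits.AtomisticToContinuum.HydrodynamicLimit.Theorems.OneFlightGossipEngineEquilibriumClampedCollisionalWindowLDStubCollisionDecompositionTaylor

/-!
# Stub `stub_collisionDecomposition` (S5) of the line `radial-virial-polarization`
# (crux `EquilibriumClampedCollisionalWindowLD`, stmt-AtomisticToContinuum-13733; repaired statement
# `ClampedTransferCoin.RadialVirial.ClampedTransferWindowLD`)

Registered obligation S5 of the lead's skeleton `Cruxes/EquilibriumClampedCollisionalWindowLD/Lines/radial_virial_polarization.lean`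
(namespace `…ClampedTransferCoin.RadialVirial`), proved verbatim (`stub_collisionDecomposition`): for smooth `φ` there is
`C ≥ 0` such that on every good orbit, for `0 < σ < 1/2`, `0 < τ`, `0 ≤ V`, the window-normalised clamped collisional
transfer `w⁻¹ X_r` of each row `r` (momentum `k` / energy) equals `w⁻¹ ε_N ×` the clamped radial virial with weight
`Γ_k = ⟨∇φ(x_fst), ω̂⟩ ω̂_k` resp. `Γ_e = ⟨∇φ(x_fst), ω̂⟩ ⟨½(v_fst⁺ + v_snd⁺), ω̂⟩`, up to `C V σ (N+1)^{2/3}`.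

Proof (pathwise, an honest finite sum on good orbits, `collisionSum_eq_finset_sum`):
* per ordered contact record (`…StubCollisionDecompositionRecords`): `x_snd = x_fst - proj(ε_N ω̂)`, `‖ω̂‖ = 1`, the jump of
  the first partner is radial and outgoing `Δv = ‖Δv‖ ω̂`, `(‖v⁺‖² - ‖v⁻‖²)/2 = ‖Δv‖ ⟨½(v_fst⁺ + v_snd⁺), ω̂⟩`, and the
  second-order Taylor bound on the torus (`…StubCollisionDecompositionTaylor`) give
  `|payload_r - ε_N Γ_r ‖Δv‖| ≤ C₂ ε_N² · impulse` in every row;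
* clamp budget (`sum_flagG_mul_impulse_le`): `Σ_records ω_fst · impulse = Σ_i ω_i (τ/σ) runAct_i ≤ (N+1)(τ/σ)V`, because
  `ω_i = 1` forces `runAct_i ≤ V`;
* normalisation: `w⁻¹ ε_N² (τ/σ) = ε_N` (`hsDiameter_mul_div`) and `ε_N (N+1) = σ (N+1)^{2/3}`; `C := C₂ / 2`.
-/

noncomputable section

open MeasureTheory Set Filter
open scoped ENNReal BigOperators
open Literature.Analysis.FluidPDE Literature.MathematicalPhysics.KineticTheory
open Literature.Analysis.FunctionSpaces (Torus.partialDeriv Torus.IsSmooth)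

namespace Summit.AtomisticToContinuum.HydrodynamicLimit.Theorems.ClampedTransferCoin

namespace RadialVirial

namespace CollisionDecomposition

open HardSphereCollisionRecord

variable {σ τ V : ℝ} {N : ℕ}

/-- **Clamp budget.** On an orbit with finitely many collision times in the window,
`Σ_records ω_fst · impulse ≤ (N+1) (τ/σ) V`: regrouping by the first particle, `Σ_{fst = i} impulse = (τ/σ) runAct_i`,
and the window-global clamp `ω_i = 1{runAct_i ≤ V}` kills every over-budget particle. -/
theorem sum_flagG_mul_impulse_le (hσ : 0 < σ) (hτ : 0 < τ) (hV : 0 ≤ V) (Φ : Flow σ N) {z : Phase N}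
    (hfin : (collisionTimes (Torus.geometry (Fin 3)) (hsDiameter σ N) (fun s => Φ.flow s z) ∩
      Set.Ioc 0 (window τ N)).Finite) :
    ∑ t ∈ hfin.toFinset, ∑ p ∈ contactPairs (Torus.geometry (Fin 3)) (hsDiameter σ N) (Φ.flow t z),
        flagG σ τ V Φ p.1 z *
          impulse (ofConfig (Torus.geometry (Fin 3)) (hsDiameter σ N) (Φ.flow t z) t p.1 p.2) ≤
      ((N : ℝ) + 1) * (τ / σ * V) := by
  set imp : ℝ → Fin (N + 1) × Fin (N + 1) → ℝ := fun t p =>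
    impulse (ofConfig (Torus.geometry (Fin 3)) (hsDiameter σ N) (Φ.flow t z) t p.1 p.2) with himp
  -- the activity sum of particle `i`
  set S : Fin (N + 1) → ℝ := fun i => ∑ t ∈ hfin.toFinset,
    ∑ p ∈ contactPairs (Torus.geometry (Fin 3)) (hsDiameter σ N) (Φ.flow t z), if p.1 = i then imp t p else 0
    with hS
  -- regroup by the first particle
  have hregroup : ∑ t ∈ hfin.toFinset, ∑ p ∈ contactPairs (Torus.geometry (Fin 3)) (hsDiameter σ N) (Φ.flow t z),
      flagG σ τ V Φ p.1 z * imp t p = ∑ i : Fin (N + 1), flagG σ τ V Φ i z * S i := by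
    simp only [hS, Finset.mul_sum, mul_ite, mul_zero]
    rw [Finset.sum_comm]
    refine Finset.sum_congr rfl fun t _ => ?_
    rw [Finset.sum_comm]
    refine Finset.sum_congr rfl fun p _ => ?_
    rw [Finset.sum_ite_eq, if_pos (Finset.mem_univ _)]
  -- `runAct_i = (σ/τ) S_i`
  have hrun : ∀ i : Fin (N + 1), runAct σ τ Φ (window τ N) i z = σ / τ * S i := by
    intro i
    unfold runAct
    rw [HardSphereFlow.collisionSum_eq, collisionSum_eq_finset_sum hfin]
    simp only [ofConfig_fst, hS, himp]
  -- each particle contributes at most `(τ/σ) V`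
  have hterm : ∀ i : Fin (N + 1), flagG σ τ V Φ i z * S i ≤ τ / σ * V := by
    intro i
    unfold flagG
    split_ifs with h
    · rw [one_mul]
      calc S i = τ / σ * runAct σ τ Φ (window τ N) i z := by rw [hrun i]; field_simp
        _ ≤ τ / σ * V := mul_le_mul_of_nonneg_left h (by positivity)
    · rw [zero_mul]; positivity
  calc ∑ t ∈ hfin.toFinset, ∑ p ∈ contactPairs (Torus.geometry (Fin 3)) (hsDiameter σ N) (Φ.flow t z),
        flagG σ τ V Φ p.1 z * imp t p = ∑ i : Fin (N + 1), flagG σ τ V Φ i z * S i := hregroup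
    _ ≤ ∑ _i : Fin (N + 1), τ / σ * V := Finset.sum_le_sum fun i _ => hterm i
    _ = ((N : ℝ) + 1) * (τ / σ * V) := by
        rw [Finset.sum_const, Finset.card_univ, Fintype.card_fin, nsmul_eq_mul]
        push_cast
        ring

/-- `ε_N (N+1) = σ (N+1)^{2/3}`. -/
theorem hsDiameter_mul_succ (σ : ℝ) (N : ℕ) :
    hsDiameter σ N * ((N : ℝ) + 1) = σ * ((N : ℝ) + 1) ^ (2 / 3 : ℝ) := by
  have hN : (0 : ℝ) < (N : ℝ) + 1 := by positivity
  unfold hsDiameter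
  push_cast
  rw [mul_assoc, ← Real.rpow_add_one hN.ne']
  norm_num

/-- **Summation of a per-record polarisation bound.** On a good orbit, if two record functionals `P`, `Q` satisfy
`|P c - ε_N Q c| ≤ C₂ ε_N² · impulse c` on every ordered contact record of the orbit, then the window-normalised clamped
collision sums of `P/2` and of `ε_N Q/2` differ by at most `(C₂/2) V σ (N+1)^{2/3}` (clamp budget + normalisation). -/
theorem abs_clamped_sum_sub_le (hσ : 0 < σ) (hτ : 0 < τ) (hV : 0 ≤ V) (Φ : Flow σ N) {z : Phase N}
    (hz : z ∈ Φ.good) {C₂ : ℝ} (hC₂ : 0 ≤ C₂) (P Q : Rec N → ℝ)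
    (hPQ : ∀ (t : ℝ), ∀ p ∈ contactPairs (Torus.geometry (Fin 3)) (hsDiameter σ N) (Φ.flow t z),
      |P (ofConfig (Torus.geometry (Fin 3)) (hsDiameter σ N) (Φ.flow t z) t p.1 p.2) -
          hsDiameter σ N * Q (ofConfig (Torus.geometry (Fin 3)) (hsDiameter σ N) (Φ.flow t z) t p.1 p.2)| ≤
        C₂ * hsDiameter σ N ^ 2 * impulse (ofConfig (Torus.geometry (Fin 3)) (hsDiameter σ N) (Φ.flow t z) t p.1 p.2)) :
    |(window τ N)⁻¹ * Φ.collisionSum (Set.Ioc 0 (window τ N))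
          (fun c => flagG σ τ V Φ c.fst z * flagG σ τ V Φ c.snd z * P c / 2) z -
        (window τ N)⁻¹ * (hsDiameter σ N * Φ.collisionSum (Set.Ioc 0 (window τ N))
          (fun c => flagG σ τ V Φ c.fst z * flagG σ τ V Φ c.snd z * Q c / 2) z)| ≤
      C₂ / 2 * V * σ * ((N : ℝ) + 1) ^ (2 / 3 : ℝ) := by
  have hw := window_pos hτ N
  have hfin : (collisionTimes (Torus.geometry (Fin 3)) (hsDiameter σ N) (fun s => Φ.flow s z) ∩
      Set.Ioc 0 (window τ N)).Finite :=
    Φ.finite_collisionTimes_inter hz Set.Ioc_subset_Icc_self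
  have hbudget := sum_flagG_mul_impulse_le (V := V) hσ hτ hV Φ hfin
  rw [← mul_sub, abs_mul, abs_of_pos (inv_pos.2 hw), HardSphereFlow.collisionSum_eq, HardSphereFlow.collisionSum_eq,
    collisionSum_eq_finset_sum hfin, collisionSum_eq_finset_sum hfin, Finset.mul_sum, ← Finset.sum_sub_distrib]
  simp only [ofConfig_fst, ofConfig_snd]
  -- pointwise bound on the summands
  have hpt : ∀ t, ∀ p ∈ contactPairs (Torus.geometry (Fin 3)) (hsDiameter σ N) (Φ.flow t z),
      |flagG σ τ V Φ p.1 z * flagG σ τ V Φ p.2 z *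
            P (ofConfig (Torus.geometry (Fin 3)) (hsDiameter σ N) (Φ.flow t z) t p.1 p.2) / 2 -
          hsDiameter σ N * (flagG σ τ V Φ p.1 z * flagG σ τ V Φ p.2 z *
            Q (ofConfig (Torus.geometry (Fin 3)) (hsDiameter σ N) (Φ.flow t z) t p.1 p.2) / 2)| ≤
        C₂ * hsDiameter σ N ^ 2 / 2 * (flagG σ τ V Φ p.1 z *
          impulse (ofConfig (Torus.geometry (Fin 3)) (hsDiameter σ N) (Φ.flow t z) t p.1 p.2)) := by
    intro t p hp
    obtain ⟨ha0, -⟩ := AdaptedClampKinematics.mem_Icc_of_eq_one_or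
      (AdaptedClampKinematics.flagG_eq_one_or (σ := σ) (τ := τ) (V := V) (z := z) Φ p.1)
    obtain ⟨hb0, hb1⟩ := AdaptedClampKinematics.mem_Icc_of_eq_one_or
      (AdaptedClampKinematics.flagG_eq_one_or (σ := σ) (τ := τ) (V := V) (z := z) Φ p.2)
    have h1 := hPQ t p hp
    set a := flagG σ τ V Φ p.1 z
    set b := flagG σ τ V Φ p.2 z
    set c := ofConfig (Torus.geometry (Fin 3)) (hsDiameter σ N) (Φ.flow t z) t p.1 p.2
    have hid : a * b * P c / 2 - hsDiameter σ N * (a * b * Q c / 2) = a * (b * (P c - hsDiameter σ N * Q c)) / 2 := by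
      ring
    rw [hid, abs_div, abs_mul, abs_mul, abs_of_nonneg ha0, abs_of_nonneg hb0, abs_two]
    have h2 : b * |P c - hsDiameter σ N * Q c| ≤ C₂ * hsDiameter σ N ^ 2 * impulse c :=
      (mul_le_mul hb1 h1 (abs_nonneg _) zero_le_one).trans_eq (one_mul _)
    calc a * (b * |P c - hsDiameter σ N * Q c|) / 2 ≤ a * (C₂ * hsDiameter σ N ^ 2 * impulse c) / 2 :=
          div_le_div_of_nonneg_right (mul_le_mul_of_nonneg_left h2 ha0) zero_le_two
      _ = C₂ * hsDiameter σ N ^ 2 / 2 * (a * impulse c) := by ring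
  have hsum : |∑ t ∈ hfin.toFinset,
      (∑ p ∈ contactPairs (Torus.geometry (Fin 3)) (hsDiameter σ N) (Φ.flow t z),
          flagG σ τ V Φ p.1 z * flagG σ τ V Φ p.2 z *
            P (ofConfig (Torus.geometry (Fin 3)) (hsDiameter σ N) (Φ.flow t z) t p.1 p.2) / 2 -
        hsDiameter σ N * ∑ p ∈ contactPairs (Torus.geometry (Fin 3)) (hsDiameter σ N) (Φ.flow t z),
          flagG σ τ V Φ p.1 z * flagG σ τ V Φ p.2 z *
            Q (ofConfig (Torus.geometry (Fin 3)) (hsDiameter σ N) (Φ.flow t z) t p.1 p.2) / 2)| ≤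
      C₂ * hsDiameter σ N ^ 2 / 2 * (((N : ℝ) + 1) * (τ / σ * V)) := by
    refine (Finset.abs_sum_le_sum_abs _ _).trans ?_
    calc ∑ t ∈ hfin.toFinset, |∑ p ∈ contactPairs (Torus.geometry (Fin 3)) (hsDiameter σ N) (Φ.flow t z),
            flagG σ τ V Φ p.1 z * flagG σ τ V Φ p.2 z *
              P (ofConfig (Torus.geometry (Fin 3)) (hsDiameter σ N) (Φ.flow t z) t p.1 p.2) / 2 -
          hsDiameter σ N * ∑ p ∈ contactPairs (Torus.geometry (Fin 3)) (hsDiameter σ N) (Φ.flow t z),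
            flagG σ τ V Φ p.1 z * flagG σ τ V Φ p.2 z *
              Q (ofConfig (Torus.geometry (Fin 3)) (hsDiameter σ N) (Φ.flow t z) t p.1 p.2) / 2|
        ≤ ∑ t ∈ hfin.toFinset, ∑ p ∈ contactPairs (Torus.geometry (Fin 3)) (hsDiameter σ N) (Φ.flow t z),
            C₂ * hsDiameter σ N ^ 2 / 2 * (flagG σ τ V Φ p.1 z *
              impulse (ofConfig (Torus.geometry (Fin 3)) (hsDiameter σ N) (Φ.flow t z) t p.1 p.2)) :=
          Finset.sum_le_sum fun t _ => by
            rw [Finset.mul_sum, ← Finset.sum_sub_distrib]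
            exact (Finset.abs_sum_le_sum_abs _ _).trans (Finset.sum_le_sum fun p hp => hpt t p hp)
      _ = C₂ * hsDiameter σ N ^ 2 / 2 * ∑ t ∈ hfin.toFinset,
            ∑ p ∈ contactPairs (Torus.geometry (Fin 3)) (hsDiameter σ N) (Φ.flow t z), flagG σ τ V Φ p.1 z *
              impulse (ofConfig (Torus.geometry (Fin 3)) (hsDiameter σ N) (Φ.flow t z) t p.1 p.2) := by
          simp only [Finset.mul_sum]
      _ ≤ C₂ * hsDiameter σ N ^ 2 / 2 * (((N : ℝ) + 1) * (τ / σ * V)) :=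
          mul_le_mul_of_nonneg_left hbudget (by positivity)
  have h1 : hsDiameter σ N * (τ / σ) = window τ N := hsDiameter_mul_div σ τ hσ.ne' N
  have h2 := hsDiameter_mul_succ σ N
  calc (window τ N)⁻¹ * _ ≤ (window τ N)⁻¹ * (C₂ * hsDiameter σ N ^ 2 / 2 * (((N : ℝ) + 1) * (τ / σ * V))) :=
        mul_le_mul_of_nonneg_left hsum (inv_nonneg.2 hw.le)
    _ = C₂ / 2 * V * (hsDiameter σ N * ((N : ℝ) + 1)) * (hsDiameter σ N * (τ / σ)) * (window τ N)⁻¹ := by ring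
    _ = C₂ / 2 * V * σ * ((N : ℝ) + 1) ^ (2 / 3 : ℝ) := by
        rw [h1, h2, mul_inv_cancel_right₀ hw.ne']
        ring

end CollisionDecomposition

open HardSphereCollisionRecord in
/-- **S5 · COLLISION DECOMPOSITION** (registered stub `stub_collisionDecomposition` of the line
`radial-virial-polarization`, verbatim). For smooth `φ` there is `C ≥ 0` such that on every good orbit, for
`0 < σ < 1/2`, `0 < τ`, `0 ≤ V`: the window-normalised clamped transfer of each row equals `w⁻¹ ε_N ×` the clamped radial
virial with weight `Γ_k = ⟨∇φ(x_fst),ω̂⟩ω̂_k` (momentum `k`) resp. `Γ_e = ⟨∇φ(x_fst),ω̂⟩⟨V_cm,ω̂⟩` (energy), up to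
`C V σ (N+1)^{2/3}` (`C = C₂/2`, `C₂` the second-order Taylor constant of `φ`). -/
theorem stub_collisionDecomposition :
    ∀ φ : T3 → ℝ, Torus.IsSmooth φ → ∃ C : ℝ, 0 ≤ C ∧
      ∀ (σ τ V : ℝ), 0 < σ → σ < 1 / 2 → 0 < τ → 0 ≤ V → ∀ (N : ℕ) (Φ : Flow σ N), ∀ z ∈ Φ.good,
        (∀ k : Fin 3,
          |(window τ N)⁻¹ * Xrow σ τ V φ Φ (some k) z -
            (window τ N)⁻¹ * (hsDiameter σ N * Φ.collisionSum (Set.Ioc 0 (window τ N))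
              (fun c => flagG σ τ V Φ c.fst z * flagG σ τ V Φ c.snd z *
                ((∑ l, Torus.partialDeriv l φ c.fstPos * c.impactVec l) * c.impactVec k *
                  ‖c.postVel.1 - c.preVel.1‖) / 2) z)| ≤ C * V * σ * ((N : ℝ) + 1) ^ (2 / 3 : ℝ)) ∧
        |(window τ N)⁻¹ * Xrow σ τ V φ Φ none z -
            (window τ N)⁻¹ * (hsDiameter σ N * Φ.collisionSum (Set.Ioc 0 (window τ N))
              (fun c => flagG σ τ V Φ c.fst z * flagG σ τ V Φ c.snd z *
                ((∑ l, Torus.partialDeriv l φ c.fstPos * c.impactVec l) *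
                  (∑ l, ((2 : ℝ)⁻¹ • (c.postVel.1 + c.postVel.2)) l * c.impactVec l) *
                  ‖c.postVel.1 - c.preVel.1‖) / 2) z)| ≤ C * V * σ * ((N : ℝ) + 1) ^ (2 / 3 : ℝ) := by
  intro φ hφ
  obtain ⟨C₂, hC₂, hT⟩ := CollisionDecomposition.exists_taylor_two_sub φ hφ
  refine ⟨C₂ / 2, by positivity, ?_⟩
  intro σ τ V hσ _hσ2 hτ hV N Φ z hz
  have hε : 0 < hsDiameter σ N := hsDiameter_pos hσ N
  have hγ := Φ.isTrajectory z hz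
  refine ⟨fun k => ?_, ?_⟩
  · exact CollisionDecomposition.abs_clamped_sum_sub_le hσ hτ hV Φ hz hC₂ (payload φ (some k))
      (fun c => (∑ l, Torus.partialDeriv l φ c.fstPos * c.impactVec l) * c.impactVec k *
        ‖c.postVel.1 - c.preVel.1‖)
      fun t p hp => (CollisionDecomposition.abs_payload_sub_le hT hε hγ hp).1 k
  · exact CollisionDecomposition.abs_clamped_sum_sub_le hσ hτ hV Φ hz hC₂ (payload φ none)
      (fun c => (∑ l, Torus.partialDeriv l φ c.fstPos * c.impactVec l) *
        (∑ l, ((2 : ℝ)⁻¹ • (c.postVel.1 + c.postVel.2)) l * c.impactVec l) * ‖c.postVel.1 - c.preVel.1‖)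
      fun t p hp => (CollisionDecomposition.abs_payload_sub_le hT hε hγ hp).2

end RadialVirial

end Summit.AtomisticToContinuum.HydrodynamicLimit.Theorems.ClampedTransferCoin

end
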